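import Summits.ResolutionOfSingularities.ResolutionOfSingularities.Theorems.ValuativeLuAlphaPTorsorValueStepHelpers
import Mathlib.RingTheory.Valuation.ValuationSubring
import Mathlib.RingTheory.Adjoin.FG
import Mathlib.Algebra.Field.Subfield.Basic

/-!
# `Valuative.LuAlphaPTorsor`, line `pfaff-line-log-final-forms`: the value step

Route `ResolutionOfSingularities/Valuative`, crux `LuAlphaPTorsor`
(stmt-ResolutionOfSingularities-0641), line `pfaff-line-log-final-forms`, registered stub
`stub_valueStep` (S4), PROVED here (statement verbatim from the ledger registration).

**Setting.** `O` a valuation ring of the field `K ⊇ k`, `R ⊆ O` a finitely generated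
`k`-subalgebra with a VERY GOOD CHART `x₁, …, xₙ ∈ R`: `xᵢ ≠ 0`, the centre `𝔪_O ∩ R` is
generated by the `xᵢ`, and the values `v(xᵢ)` are `ℤ`-independent. The VALUE STEP of the purely
inseparable tower: `t ^ p = x^α · u` with `u` a unit of `R` of value `1` and `v(t)` NOT in the
lattice `Λ = ⊕ ℤ v(xᵢ)` (`p` prime). **Claim.** There is a very good chart `(R', y)` with
`R ≤ R' ∋ t`, `R'` finitely generated, `R' ⊆ Frac (R[t])`.

**Proof (toric re-basing).** `v(t) ^ p = v(x^α) ≤ 1`, so `v(t) ≤ 1`. The lattice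
`Γ' = ⟨v(x), v(t)⟩ ⊆ Γ₀ˣ` has rank `n` and Zariski–Perron re-bases it
(`valueStep_lattice_rebase`, from `exists_basis_lt_one_of_injective` of
`Literature/…/PerronTransforms.lean`): values `εⱼ = v(x^{Aⱼ} t^{Bⱼ}) < 1`, `j < n`, forming a
`ℤ`-basis in which `v(xᵢ) = ∏ εⱼ^{C i j}` and `v(t) = ∏ εⱼ^{Dⱼ}` with exponents in `ℕ`. Put
`yⱼ := x^{Aⱼ} · t^{Bⱼ}` (Laurent monomials, `v(yⱼ) = εⱼ`). A Laurent monomial `x^a t^b` of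
value `1` is a power of `u` (`valueStep_mono_eq_zpow`: reduce `b` mod `p` via `t^p = x^α u`;
`v(t)^r ∈ Λ` with `0 < r < p` would put `v(t) ∈ Λ` by Bezout), hence a unit of `R`. So
`xᵢ = y^{Cᵢ} · wᵢ` and `t = y^D · w` with units `wᵢ, w` of `R`, and `R' := R[y₁, …, yₙ]`
contains `t`, lies in `O` and in `Frac (R[t])`, and is finitely generated. Its centre is `(y)`:
`⊇` as `v(yⱼ) < 1`; `⊆`: every `z ∈ R[y]` is `r + i` with `r ∈ R`, `i ∈ (y)`; if `v(z) < 1`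
then `v(r) < 1`, so `r ∈ 𝔪_O ∩ R = (x) ⊆ (y)` (`Cᵢ ≠ 0` because `v(xᵢ) < 1`). The values
`v(yⱼ) = εⱼ` are `ℤ`-independent, being a `ℤ`-basis.
-/

noncomputable section

-- `Summit.<S>.<S>.…` duplicates the summit name by design (D-0017, single-problem summit).
set_option linter.dupNamespace false

open IsLocalRing

namespace Summit.ResolutionOfSingularities.ResolutionOfSingularities.Theorems.PfaffLine

open Literature.AlgebraicGeometry.Resolution

section Field

variable {K : Type} [Field K]

/-- Centre membership: for a subring `S ⊆ O`, an element of `S` lies in the contraction of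
`𝔪_O` iff its value is `< 1`. -/
theorem valueStep_mem_centre_iff (O : ValuationSubring K) {S : Subring K}
    (h : S ≤ O.toSubring) (z : S) :
    z ∈ Ideal.comap (Subring.inclusion h) (maximalIdeal O) ↔ O.valuation (z : K) < 1 := by
  rw [Ideal.mem_comap, ValuationSubring.valuation_lt_one_iff]
  rfl

/-- Integer powers of a unit `u` of a subalgebra `R` (`u, u⁻¹ ∈ R`) lie in `R`. -/
theorem valueStep_zpow_mem {k : Type} [Field k] [Algebra k K] (R : Subalgebra k K) {u : K}
    (hu : u ∈ R) (hui : u⁻¹ ∈ R) (q : ℤ) : u ^ q ∈ R := by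
  cases q with
  | ofNat m => rw [Int.ofNat_eq_natCast, zpow_natCast]; exact R.pow_mem hu m
  | negSucc m => rw [zpow_negSucc, ← inv_pow]; exact R.pow_mem hui _

/-- **Laurent monomials of value `1` are powers of `u`.** In the setting of the value step
(`t ^ p = x^α · u`, `v(u) = 1`, values of the `xᵢ` `ℤ`-independent, `v(t) ∉ ⊕ ℤ v(xᵢ)`,
`p` prime), a Laurent monomial `x^a · t ^ b` of value `1` equals `u ^ q` for some `q ∈ ℤ`:
write `b = p q + r` with `0 ≤ r < p`, so that `x^a t^b = x^{a + qα} t^r u^q`, and apply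
`valueStep_kernel`. -/
theorem valueStep_mono_eq_zpow (O : ValuationSubring K) {p : ℕ} (hp : p.Prime) {n : ℕ}
    (x : Fin n → K) (hx0 : ∀ i, x i ≠ 0)
    (hind : ∀ m : Fin n → ℤ, (∏ i, O.valuation (x i) ^ (m i)) = 1 → m = 0)
    (t u : K) (ht0 : t ≠ 0) (α : Fin n → ℕ) (hvu : O.valuation u = 1)
    (htp : t ^ p = (∏ i, x i ^ (α i)) * u)
    (hvt : ∀ m : Fin n → ℤ, O.valuation t ≠ ∏ i, O.valuation (x i) ^ (m i))
    (a : Fin n → ℤ) (b : ℤ) (h1 : O.valuation ((∏ i, x i ^ (a i)) * t ^ b) = 1) :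
    ∃ q : ℤ, (∏ i, x i ^ (a i)) * t ^ b = u ^ q := by
  have hp0 : (p : ℤ) ≠ 0 := by exact_mod_cast hp.ne_zero
  have hvx0 : ∀ i, O.valuation (x i) ≠ 0 := fun i => (Valuation.ne_zero_iff _).mpr (hx0 i)
  have hvt0 : O.valuation t ≠ 0 := (Valuation.ne_zero_iff _).mpr ht0
  have hvmono : ∀ c : Fin n → ℤ,
      O.valuation (∏ i, x i ^ (c i)) = ∏ i, O.valuation (x i) ^ (c i) := fun c => by
    rw [map_prod]
    exact Finset.prod_congr rfl fun i _ => map_zpow₀ _ _ _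
  have hvtp : O.valuation t ^ p = ∏ i, O.valuation (x i) ^ (α i) := by
    rw [← map_pow, htp, map_mul, hvu, mul_one, map_prod]
    exact Finset.prod_congr rfl fun i _ => map_pow _ _ _
  -- `b = p q + r` with `0 ≤ r < p`
  obtain ⟨q, r, hr, hbr⟩ : ∃ (q : ℤ) (r : ℕ), r < p ∧ b = p * q + r := by
    refine ⟨b / p, (b % p).toNat, ?_, ?_⟩
    · have h2 := Int.emod_lt_of_pos b (by exact_mod_cast hp.pos : (0 : ℤ) < p)
      have h3 := Int.emod_nonneg b hp0
      omega
    · rw [Int.toNat_of_nonneg (Int.emod_nonneg b hp0)]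
      exact (Int.mul_ediv_add_emod b p).symm
  -- `x^a t^b = x^(a + q α) t^r u^q`
  let α' : Fin n → ℤ := fun i => (α i : ℤ)
  have hxα : (∏ i, x i ^ (α i)) = ∏ i, x i ^ (α' i) :=
    Finset.prod_congr rfl fun i _ => (zpow_natCast _ _).symm
  have hdec : (∏ i, x i ^ (a i)) * t ^ b =
      (∏ i, x i ^ ((a + q • α') i)) * t ^ r * u ^ q := by
    rw [hbr, zpow_add₀ ht0, zpow_mul, zpow_natCast, htp, hxα, zpow_natCast, mul_zpow,
      ← prod_zpow_smul_eq, prod_zpow_add_eq x hx0]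
    ring
  -- of value `v(x^(a + qα)) v(t)^r = 1`
  have hval : (∏ i, O.valuation (x i) ^ ((a + q • α') i)) * O.valuation t ^ r = 1 := by
    rw [hdec, map_mul, map_mul, map_pow, map_zpow₀, hvu, one_zpow, mul_one, hvmono] at h1
    exact h1
  obtain ⟨hr0, ha⟩ := valueStep_kernel hp (fun i => O.valuation (x i)) hvx0 hind (O.valuation t)
    hvt0 α hvtp hvt (a + q • α') r hr hval
  refine ⟨q, ?_⟩
  rw [hdec, ha, hr0, pow_zero, mul_one]
  simp

end Field

/-- **Stub `stub_valueStep` (S4) of the line `pfaff-line-log-final-forms`** (crux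
`Valuative.LuAlphaPTorsor`, stmt-ResolutionOfSingularities-0641): the value step of the purely
inseparable tower — if `t ^ p = x^α · u` with `u` a unit of `R` of value `1` and `v(t)` outside
the value lattice of the very good chart `(R, x)`, then `Frac (R[t])` carries a very good chart
`(R', y)` with `R ≤ R' ∋ t`. See the module docstring for the proof. -/
theorem stub_valueStep :
    ∀ p : ℕ, p.Prime → ∀ (k K : Type) [Field k] [Field K] [Algebra k K] (O : ValuationSubring K) (n : ℕ) (R : Subalgebra k K) (hRO : R.toSubring ≤ O.toSubring) (x : Fin n → K) (hx : ∀ i, x i ∈ R), R.FG → (∀ i, x i ≠ 0) → Ideal.span (Set.range fun i => (⟨x i, hx i⟩ : R.toSubring)) = Ideal.comap (Subring.inclusion hRO) (IsLocalRing.maximalIdeal O) → (∀ m : Fin n → ℤ, (∏ i, O.valuation (x i) ^ (m i)) = 1 → m = 0) → ∀ (t u : K) (α : Fin n → ℕ), u ∈ R → u⁻¹ ∈ R → O.valuation u = 1 → t ^ p = (∏ i, x i ^ (α i)) * u → (∀ m : Fin n → ℤ, O.valuation t ≠ ∏ i, O.valuation (x i) ^ (m i)) → ∃ (R' : Subalgebra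 k K) (hR'O : R'.toSubring ≤ O.toSubring) (y : Fin n → K) (hy : ∀ i, y i ∈ R'), R ≤ R' ∧ t ∈ R' ∧ R'.FG ∧ ((R' : Set K) ⊆ Subfield.closure ((R : Set K) ∪ {t})) ∧ (∀ i, y i ≠ 0) ∧ Ideal.span (Set.range fun i => (⟨y i, hy i⟩ : R'.toSubring)) = Ideal.comap (Subring.inclusion hR'O) (IsLocalRing.maximalIdeal O) ∧ (∀ m : Fin n → ℤ, (∏ i, O.valuation (y i) ^ (m i)) = 1 → m = 0) := by
  intro p hp k K _ _ _ O n R hRO x hx hRfg hx0 hcen hind t u α huR huiR hvu htp hvt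
  classical
  -- ### non-vanishing and values
  have hp0 : p ≠ 0 := hp.ne_zero
  have hu0 : u ≠ 0 := fun h => zero_ne_one (by rw [← hvu, h, map_zero])
  have ht0 : t ≠ 0 := by
    rintro rfl
    rw [zero_pow hp0, zero_eq_mul] at htp
    rcases htp with h | h
    · exact Finset.prod_ne_zero_iff.mpr (fun i _ => pow_ne_zero _ (hx0 i)) h
    · exact hu0 h
  have hvx0 : ∀ i, O.valuation (x i) ≠ 0 := fun i => (Valuation.ne_zero_iff _).mpr (hx0 i)
  have hvt0 : O.valuation t ≠ 0 := (Valuation.ne_zero_iff _).mpr ht0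
  have hvx1 : ∀ i, O.valuation (x i) < 1 := fun i =>
    (valueStep_mem_centre_iff O hRO ⟨x i, hx i⟩).mp (by
      rw [← hcen]
      exact Ideal.subset_span ⟨i, rfl⟩)
  have hvtp : O.valuation t ^ p = ∏ i, O.valuation (x i) ^ (α i) := by
    rw [← map_pow, htp, map_mul, hvu, mul_one, map_prod]
    exact Finset.prod_congr rfl fun i _ => map_pow _ _ _
  have hvt1 : O.valuation t ≤ 1 := by
    rw [← pow_le_one_iff hp0, hvtp]
    exact Finset.prod_le_one' fun i _ => pow_le_one' (hvx1 i).le _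
  have hvmono : ∀ c : Fin n → ℤ,
      O.valuation (∏ i, x i ^ (c i)) = ∏ i, O.valuation (x i) ^ (c i) := fun c => by
    rw [map_prod]
    exact Finset.prod_congr rfl fun i _ => map_zpow₀ _ _ _
  -- ### the re-based value lattice
  obtain ⟨ε, A, B, C, D, hε0, hε1, hεAB, hτC, hθD, hεind⟩ :=
    valueStep_lattice_rebase hp0 (fun i => O.valuation (x i)) hvx0 (fun i => (hvx1 i).le) hind
      (O.valuation t) hvt0 hvt1 α hvtp
  -- ### the new coordinates `y`
  let y : Fin n → K := fun j => (∏ i, x i ^ (A j i)) * t ^ (B j)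
  have hvy : ∀ j, O.valuation (y j) = ε j := fun j => by
    rw [hεAB j, ← hvmono, ← map_zpow₀, ← map_mul]
  have hvy1 : ∀ j, O.valuation (y j) < 1 := fun j => by
    rw [hvy]
    exact hε1 j
  have hy0 : ∀ j, y j ≠ 0 := fun j h => hε0 j (by rw [← hvy, h, map_zero])
  have hyO : ∀ j, y j ∈ O := fun j => (O.valuation_le_one_iff _).mp (hvy1 j).le
  -- ### Laurent monomials in `x, t`
  let IsMono : K → Prop := fun z => ∃ (a : Fin n → ℤ) (b : ℤ), z = (∏ i, x i ^ (a i)) * t ^ b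
  have mono_mul : ∀ z w, IsMono z → IsMono w → IsMono (z * w) := by
    rintro z w ⟨a, b, rfl⟩ ⟨a', b', rfl⟩
    refine ⟨a + a', b + b', ?_⟩
    rw [prod_zpow_add_eq x hx0, zpow_add₀ ht0]
    ring
  have mono_inv : ∀ z, IsMono z → IsMono z⁻¹ := by
    rintro z ⟨a, b, rfl⟩
    refine ⟨-a, -b, ?_⟩
    rw [prod_zpow_neg_eq, zpow_neg, mul_inv]
  have mono_one : IsMono 1 := ⟨0, 0, by simp⟩
  have mono_prod : ∀ f : Fin n → K, (∀ j, IsMono (f j)) → IsMono (∏ j, f j) := fun f hf =>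
    Finset.prod_induction f IsMono (fun a b ha hb => mono_mul a b ha hb) mono_one fun j _ => hf j
  have mono_pow : ∀ (z : K) (m : ℕ), IsMono z → IsMono (z ^ m) := fun z m hz => by
    induction m with
    | zero => simpa using mono_one
    | succ m ih =>
      rw [pow_succ]
      exact mono_mul _ _ ih hz
  have mono_x : ∀ i, IsMono (x i) := fun i => ⟨Pi.single i 1, 0, by
    rw [zpow_zero, mul_one, Finset.prod_eq_single i (fun j _ hj => by
      rw [Pi.single_eq_of_ne hj, zpow_zero]) (fun h => absurd (Finset.mem_univ i) h),
      Pi.single_eq_same, zpow_one]⟩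
  have mono_t : IsMono t := ⟨0, 1, by simp⟩
  have mono_y : ∀ j, IsMono (y j) := fun j => ⟨A j, B j, rfl⟩
  -- Laurent monomials lie in `Frac (R[t])`
  have hxF : ∀ i, x i ∈ Subfield.closure ((R : Set K) ∪ {t}) := fun i =>
    Subfield.subset_closure (Or.inl (hx i))
  have htF : t ∈ Subfield.closure ((R : Set K) ∪ {t}) :=
    Subfield.subset_closure (Or.inr rfl)
  have mono_mem_closure : ∀ z, IsMono z → z ∈ Subfield.closure ((R : Set K) ∪ {t}) := by
    rintro z ⟨a, b, rfl⟩
    exact mul_mem (prod_mem fun i _ => zpow_mem (hxF i) _) (zpow_mem htF _)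
  -- Laurent monomials of value `1` are units of `R`
  have mono_unit : ∀ z, IsMono z → O.valuation z = 1 → z ∈ R ∧ z⁻¹ ∈ R := by
    rintro z ⟨a, b, rfl⟩ h1
    obtain ⟨q, hq⟩ := valueStep_mono_eq_zpow O hp x hx0 hind t u ht0 α hvu htp hvt a b h1
    rw [hq, ← zpow_neg]
    exact ⟨valueStep_zpow_mem R huR huiR q, valueStep_zpow_mem R huR huiR (-q)⟩
  -- ### `x i` and `t` are monomials in `y` up to units of `R`
  have hdecomp : ∀ (z : K) (c : Fin n → ℕ), IsMono z → O.valuation z = ∏ j, ε j ^ (c j) →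
      ∃ w, w ∈ R ∧ w⁻¹ ∈ R ∧ z = (∏ j, y j ^ (c j)) * w := by
    intro z c hz hvz
    have hP0 : (∏ j, y j ^ (c j)) ≠ 0 :=
      Finset.prod_ne_zero_iff.mpr fun j _ => pow_ne_zero _ (hy0 j)
    obtain ⟨h1, h2⟩ := mono_unit _
      (mono_mul _ _ hz (mono_inv _ (mono_prod _ fun j => mono_pow _ _ (mono_y j)))) (by
        rw [map_mul, map_inv₀, hvz, map_prod]
        simp_rw [map_pow, hvy]
        exact mul_inv_cancel₀ (Finset.prod_ne_zero_iff.mpr fun j _ => pow_ne_zero _ (hε0 j)))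
    refine ⟨z * (∏ j, y j ^ (c j))⁻¹, h1, h2, ?_⟩
    rw [mul_left_comm, mul_inv_cancel₀ hP0, mul_one]
  have hxdec : ∀ i, ∃ w, w ∈ R ∧ w⁻¹ ∈ R ∧ x i = (∏ j, y j ^ (C i j)) * w :=
    fun i => hdecomp (x i) (C i) (mono_x i) (hτC i)
  obtain ⟨wt, hwtR, -, htwt⟩ := hdecomp t D mono_t hθD
  -- ### the new chart `R' = R[y]`
  let R' : Subalgebra k K := Algebra.adjoin k ((R : Set K) ∪ Set.range y)
  have hRR' : R ≤ R' := fun z hz => Algebra.subset_adjoin (Or.inl hz)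
  have hyR' : ∀ j, y j ∈ R' := fun j => Algebra.subset_adjoin (Or.inr ⟨j, rfl⟩)
  have hR'le : ∀ S : Subring K, R.toSubring ≤ S → (∀ j, y j ∈ S) → R'.toSubring ≤ S := by
    intro S h1 h2
    let Salg : Subalgebra k K := { S with algebraMap_mem' := fun c => h1 (R.algebraMap_mem c) }
    change R' ≤ Salg
    refine Algebra.adjoin_le ?_
    rintro z (hz | ⟨j, rfl⟩)
    exacts [h1 hz, h2 j]
  have hR'O : R'.toSubring ≤ O.toSubring := hR'le O.toSubring hRO fun j => hyO j
  have htR' : t ∈ R' := by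
    rw [htwt]
    exact mul_mem (prod_mem fun j _ => pow_mem (hyR' j) _) (hRR' hwtR)
  have hR'fg : R'.FG := by
    obtain ⟨S₀, hS₀⟩ := hRfg
    refine Subalgebra.fg_def.mpr
      ⟨↑S₀ ∪ Set.range y, S₀.finite_toSet.union (Set.finite_range y), ?_⟩
    change Algebra.adjoin k (↑S₀ ∪ Set.range y) = Algebra.adjoin k (↑R ∪ Set.range y)
    rw [Algebra.adjoin_union, Algebra.adjoin_union, hS₀, Algebra.adjoin_eq]
  have hR'F : (R' : Set K) ⊆ Subfield.closure ((R : Set K) ∪ {t}) := fun z hz =>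
    hR'le (Subfield.closure ((R : Set K) ∪ {t})).toSubring
      (fun w hw => Subfield.subset_closure (Or.inl hw)) (fun j => mono_mem_closure _ (mono_y j)) hz
  -- ### the centre of `R'` is generated by `y`
  have hcen' : Ideal.span (Set.range fun i => (⟨y i, hyR' i⟩ : R'.toSubring)) =
      Ideal.comap (Subring.inclusion hR'O) (IsLocalRing.maximalIdeal O) := by
    set I := Ideal.span (Set.range fun i => (⟨y i, hyR' i⟩ : R'.toSubring)) with hI
    -- `(y) ⊆ centre`
    have hle : I ≤ Ideal.comap (Subring.inclusion hR'O) (maximalIdeal O) := by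
      refine Ideal.span_le.mpr ?_
      rintro _ ⟨j, rfl⟩
      exact (valueStep_mem_centre_iff O hR'O _).mpr (hvy1 j)
    refine le_antisymm hle fun z hz => ?_
    have hvz : O.valuation (z : K) < 1 := (valueStep_mem_centre_iff O hR'O z).mp hz
    -- `x i ∈ (y)`
    have hxI : ∀ i, (⟨x i, hRR' (hx i)⟩ : R'.toSubring) ∈ I := by
      intro i
      obtain ⟨w, hwR, -, hxw⟩ := hxdec i
      by_cases hC : ∃ j, C i j ≠ 0
      · obtain ⟨j₀, hj₀⟩ := hC
        have hP : (∏ j, (⟨y j, hyR' j⟩ : R'.toSubring) ^ (C i j)) ∈ I := by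
          rw [← Finset.mul_prod_erase Finset.univ _ (Finset.mem_univ j₀)]
          exact I.mul_mem_right _
            (I.pow_mem_of_mem (Ideal.subset_span ⟨j₀, rfl⟩) _ (Nat.pos_of_ne_zero hj₀))
        have heq : (⟨x i, hRR' (hx i)⟩ : R'.toSubring) =
            (∏ j, (⟨y j, hyR' j⟩ : R'.toSubring) ^ (C i j)) * ⟨w, hRR' hwR⟩ :=
          Subtype.ext (by push_cast; exact hxw)
        rw [heq]
        exact I.mul_mem_right _ hP
      · push Not at hC
        exfalso
        refine (hvx1 i).ne ?_
        rw [hτC i]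
        exact Finset.prod_eq_one fun j _ => by rw [hC j, pow_zero]
    -- `R' = R + (y)`
    have hQ : ∀ (w : K) (hw : w ∈ R'),
        ∃ r : R'.toSubring, (r : K) ∈ R ∧ (⟨w, hw⟩ : R'.toSubring) - r ∈ I := by
      intro w hw
      refine Algebra.adjoin_induction (p := fun w hw =>
        ∃ r : R'.toSubring, (r : K) ∈ R ∧ (⟨w, hw⟩ : R'.toSubring) - r ∈ I) ?_ ?_ ?_ ?_ hw
      · rintro w (hwR | ⟨j, rfl⟩)
        · exact ⟨⟨w, hRR' hwR⟩, hwR, by rw [sub_self]; exact I.zero_mem⟩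
        · exact ⟨0, R.zero_mem, by rw [sub_zero]; exact Ideal.subset_span ⟨j, rfl⟩⟩
      · intro c
        exact ⟨⟨_, hRR' (R.algebraMap_mem c)⟩, R.algebraMap_mem c, by
          rw [sub_self]; exact I.zero_mem⟩
      · rintro w₁ w₂ hw₁ hw₂ ⟨r₁, hr₁, h₁⟩ ⟨r₂, hr₂, h₂⟩
        refine ⟨r₁ + r₂, R.add_mem hr₁ hr₂, ?_⟩
        have h := I.add_mem h₁ h₂
        rwa [← add_sub_add_comm] at h
      · rintro w₁ w₂ hw₁ hw₂ ⟨r₁, hr₁, h₁⟩ ⟨r₂, hr₂, h₂⟩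
        refine ⟨r₁ * r₂, R.mul_mem hr₁ hr₂, ?_⟩
        have h := I.add_mem (I.mul_mem_left ⟨w₁, hw₁⟩ h₂) (I.mul_mem_right r₂ h₁)
        have e : (⟨w₁ * w₂, mul_mem hw₁ hw₂⟩ : R'.toSubring) - r₁ * r₂ =
            ⟨w₁, hw₁⟩ * (⟨w₂, hw₂⟩ - r₂) + (⟨w₁, hw₁⟩ - r₁) * r₂ := by
          rw [show (⟨w₁ * w₂, mul_mem hw₁ hw₂⟩ : R'.toSubring) = ⟨w₁, hw₁⟩ * ⟨w₂, hw₂⟩ from rfl]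
          ring
        rw [e]
        exact h
    obtain ⟨r, hrR, hzr⟩ := hQ z z.2
    have hvzr := (valueStep_mem_centre_iff O hR'O _).mp (hle hzr)
    have hvr : O.valuation (r : K) < 1 := by
      have e : (r : K) = z - ((⟨(z : K), z.2⟩ - r : R'.toSubring) : K) := by
        push_cast
        ring
      rw [e]
      exact Valuation.map_sub_lt _ hvz hvzr
    have hr_span : (⟨r, hrR⟩ : R.toSubring) ∈
        Ideal.span (Set.range fun i => (⟨x i, hx i⟩ : R.toSubring)) := by
      rw [hcen]
      exact (valueStep_mem_centre_iff O hRO ⟨r, hrR⟩).mpr hvr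
    have hRR's : R.toSubring ≤ R'.toSubring := fun _ h => hRR' h
    have hrI : r ∈ I := by
      have hle' : Ideal.span (Set.range fun i => (⟨x i, hx i⟩ : R.toSubring)) ≤
          I.comap (Subring.inclusion hRR's) :=
        Ideal.span_le.mpr (by
          rintro _ ⟨i, rfl⟩
          exact hxI i)
      have h := hle' hr_span
      rw [Ideal.mem_comap] at h
      have e : Subring.inclusion hRR's ⟨r, hrR⟩ = r := Subtype.ext rfl
      rwa [e] at h
    simpa using I.add_mem hzr hrI
  refine ⟨R', hR'O, y, hyR', hRR', htR', hR'fg, hR'F, hy0, hcen', fun m hm => hεind m ?_⟩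
  rw [← hm]
  exact Finset.prod_congr rfl fun j _ => by rw [hvy]

end Summit.ResolutionOfSingularities.ResolutionOfSingularities.Theorems.PfaffLine

end
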